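import Summits.AtomisticToContinuum.Crystallization.Theorems.OverbindingBudgetElasticSplitStatements

/-!
# OverbindingBudget — «ElasticSplit»: the dilation test, PROVED, and the cone of the split (decomp-a2c lens-4, generation 27; proofs)

Helper file (`--supports stmt-AtomisticToContinuum-31280`; statements and reading in `…OverbindingBudgetElasticSplitStatements`).

* §1 **The dilation identity.**  Along the homotheties `x ↦ λ x` the Lennard-Jones energy of a finite chunk `F` is the quadratic polynomial
  `U(λF) = λ⁻¹² S₁₂/24 − λ⁻⁶ S₆/12` in `μ = λ⁻⁶` (`interactionEnergy_dilate`), minimal at `μ⋆ = S₆/S₁₂` with value `−S₆²/(24 S₁₂)`; hence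
  **`E(#F) + dilationGain F ≤ U(F)`** with `dilationGain F = (S₁₂ − S₆)²/(24 S₁₂)` for EVERY finite chunk, no hypothesis
  (`groundStateEnergy_add_dilationGain_le`) — an exact, elementary COMPETITOR BOUND in the currency of `StrainedCubes`.
* §2 `strainedCubes_of_dilationStrained : DilationStrainedCubes κ Y → StrainedCubes κ Y` (the DILATION TEST), the sparse branch
  `sparseChargeRelax_of_tests : LocalRelaxationTest → ElasticLiouvilleLaw → SparseChargeRelax`, RELAX from the split
  `edgeRelaxationLaw_of_split : ChargeDensityRelax → LocalRelaxationTest → ElasticLiouvilleLaw → EdgeRelaxationLaw`, and the cones to the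
  crux `RobustDefectLimitWindows` through the g26 record cone `rdef_of_grossU_edgeRelaxation_coherent`.
-/

namespace Summit.AtomisticToContinuum.Crystallization.Theorems.OverbindingBudgetElasticSplitDilation

open Filter Metric Set Topology
open scoped BigOperators
open Literature.MathematicalPhysics.StatisticalMechanics
open Summit.AtomisticToContinuum.Crystallization.Theses.OverbindingBudget (RobustDefectLimitWindows)
open Summit.AtomisticToContinuum.Crystallization.Theorems.OverbindingBudgetGradedBareness (CleanlessExcessT)
open Summit.AtomisticToContinuum.Crystallization.Theorems.OverbindingBudgetCoherentCut (CoherentResidual)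
open Summit.AtomisticToContinuum.Crystallization.Theorems.OverbindingBudgetUniformCutStatements (GrossCleanBallsU)
open Summit.AtomisticToContinuum.Crystallization.Theorems.OverbindingBudgetEdgeRelaxationStatements
  (StrainedCubes CleanClass EdgeRelaxationLaw)
open Summit.AtomisticToContinuum.Crystallization.Theorems.OverbindingBudgetEdgeRelaxation (rdef_of_grossU_edgeRelaxation_coherent)
open Summit.AtomisticToContinuum.Crystallization.Theorems.OverbindingBudgetElasticSplitStatements

/-! ## §1  The dilation identity and the competitor bound -/

/-- The canonical injective enumeration of a finite chunk. -/
noncomputable def enum (F : Finset (EuclideanSpace ℝ (Fin 3))) : Fin F.card → EuclideanSpace ℝ (Fin 3) :=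
  fun i => ((F.equivFin.symm i : F) : EuclideanSpace ℝ (Fin 3))

/-- The enumeration is injective. [this file] -/
theorem enum_injective (F : Finset (EuclideanSpace ℝ (Fin 3))) : Function.Injective (enum F) :=
  fun _ _ h => F.equivFin.symm.injective (Subtype.val_injective h)

/-- Double sums over the enumeration are double sums over the chunk. [this file] -/
theorem sum_sum_enum (F : Finset (EuclideanSpace ℝ (Fin 3))) (f : EuclideanSpace ℝ (Fin 3) → EuclideanSpace ℝ (Fin 3) → ℝ) :
    ∑ i, ∑ j, f (enum F i) (enum F j) = ∑ y ∈ F, ∑ w ∈ F, f y w := by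
  have inner : ∀ x : EuclideanSpace ℝ (Fin 3), ∑ j, f x (enum F j) = ∑ w ∈ F, f x w := by
    intro x
    rw [Fintype.sum_equiv F.equivFin.symm (fun j => f x (enum F j)) (fun c => f x (c : EuclideanSpace ℝ (Fin 3))) (fun _ => rfl)]
    exact Finset.sum_coe_sort F (fun w => f x w)
  simp_rw [inner]
  rw [Fintype.sum_equiv F.equivFin.symm (fun i => ∑ w ∈ F, f (enum F i) w)
    (fun c => ∑ w ∈ F, f (c : EuclideanSpace ℝ (Fin 3)) w) (fun _ => rfl)]
  exact Finset.sum_coe_sort F (fun y => ∑ w ∈ F, f y w)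

/-- Lennard-Jones along a dilation: `V_LJ(λ d) = λ⁻¹² d⁻¹²/12 − λ⁻⁶ d⁻⁶/6`. [this file] -/
theorem lennardJones_mul (l d : ℝ) :
    lennardJones (l * d) = 1 / 12 * (l⁻¹ ^ 12 * d⁻¹ ^ 12) - 1 / 6 * (l⁻¹ ^ 6 * d⁻¹ ^ 6) := by
  unfold lennardJones
  rw [mul_inv, mul_pow, mul_pow]

/-- The chunk energy in the virial currency: `½ ∑∑ V_LJ = S₁₂/24 − S₆/12`. [this file] -/
theorem half_sum_sum_lennardJones (F : Finset (EuclideanSpace ℝ (Fin 3))) :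
    1 / 2 * ∑ y ∈ F, ∑ w ∈ F, lennardJones (dist y w) = invPowSum 12 F / 24 - invPowSum 6 F / 12 := by
  have h : ∀ y w : EuclideanSpace ℝ (Fin 3),
      lennardJones (dist y w) = 1 / 12 * (dist y w)⁻¹ ^ 12 - 1 / 6 * (dist y w)⁻¹ ^ 6 := fun _ _ => rfl
  simp only [h, Finset.sum_sub_distrib, ← Finset.mul_sum]
  unfold invPowSum
  ring

/-- Twice the energy of the `λ`-dilated enumeration: `∑∑_F V_LJ(λ · dist)`. [this file] -/
theorem two_mul_interactionEnergy_dilate (F : Finset (EuclideanSpace ℝ (Fin 3))) {l : ℝ} (hl : 0 ≤ l) :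
    2 * interactionEnergy lennardJones (fun i => l • enum F i) = ∑ y ∈ F, ∑ w ∈ F, lennardJones (l * dist y w) := by
  rw [two_mul_interactionEnergy_eq_sum_sum lennardJones lennardJones_zero]
  have h : ∀ i j : Fin F.card, dist (l • enum F i) (l • enum F j) = l * dist (enum F i) (enum F j) := by
    intro i j
    rw [dist_smul₀, Real.norm_of_nonneg hl]
  simp_rw [h]
  exact sum_sum_enum F (fun y w => lennardJones (l * dist y w))

/-- **The dilation identity**: `U(λ · F) = λ⁻¹² S₁₂(F)/24 − λ⁻⁶ S₆(F)/12` (`λ ≥ 0`). [this file] -/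
theorem interactionEnergy_dilate (F : Finset (EuclideanSpace ℝ (Fin 3))) {l : ℝ} (hl : 0 ≤ l) :
    interactionEnergy lennardJones (fun i => l • enum F i) = l⁻¹ ^ 12 * invPowSum 12 F / 24 - l⁻¹ ^ 6 * invPowSum 6 F / 12 := by
  have h2 := two_mul_interactionEnergy_dilate F hl
  simp only [lennardJones_mul, Finset.sum_sub_distrib, ← Finset.mul_sum] at h2
  unfold invPowSum
  linarith

/-- The undilated enumeration has the chunk energy: `U(enum F) = ½ ∑∑_F V_LJ`. [this file] -/
theorem interactionEnergy_enum (F : Finset (EuclideanSpace ℝ (Fin 3))) :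
    interactionEnergy lennardJones (enum F) = 1 / 2 * ∑ y ∈ F, ∑ w ∈ F, lennardJones (dist y w) := by
  have h := interactionEnergy_dilate F zero_le_one
  simp only [one_smul, inv_one, one_pow, one_mul] at h
  rw [half_sum_sum_lennardJones]
  exact h

/-- If `S₆(F) = 0` then `S₁₂(F) = 0` (both vanish iff the chunk has at most one point). [this file] -/
theorem invPowSum_twelve_eq_zero {F : Finset (EuclideanSpace ℝ (Fin 3))} (h : invPowSum 6 F = 0) : invPowSum 12 F = 0 := by
  unfold invPowSum at h ⊢
  have hnn : ∀ y ∈ F, 0 ≤ ∑ w ∈ F, (dist y w)⁻¹ ^ 6 :=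
    fun y _ => Finset.sum_nonneg fun w _ => pow_nonneg (inv_nonneg.2 dist_nonneg) _
  rw [Finset.sum_eq_zero_iff_of_nonneg hnn] at h
  refine Finset.sum_eq_zero fun y hy => Finset.sum_eq_zero fun w hw => ?_
  have hy0 := h y hy
  rw [Finset.sum_eq_zero_iff_of_nonneg (fun w _ => pow_nonneg (inv_nonneg.2 dist_nonneg) _)] at hy0
  have h6 : (dist y w)⁻¹ ^ 6 = 0 := hy0 w hw
  have h0 : (dist y w)⁻¹ = 0 := pow_eq_zero_iff (by norm_num) |>.1 h6
  rw [h0]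
  norm_num

/-- **The competitor bound of the dilation test**: `E(#F) + dilationGain F ≤ ½ ∑∑_F V_LJ` for EVERY finite chunk `F ⊆ ℝ³` — the optimal
homothety of the chunk is an `#F`-particle competitor releasing exactly `(S₁₂ − S₆)²/(24 S₁₂)`. [this file] -/
theorem groundStateEnergy_add_dilationGain_le (F : Finset (EuclideanSpace ℝ (Fin 3))) :
    groundStateEnergy lennardJones 3 F.card + dilationGain F ≤ 1 / 2 * ∑ y ∈ F, ∑ w ∈ F, lennardJones (dist y w) := by
  have hU := interactionEnergy_enum F
  by_cases h6 : invPowSum 6 F = 0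
  · -- degenerate chunk: no gain, the enumeration itself is the competitor
    have h12 : invPowSum 12 F = 0 := invPowSum_twelve_eq_zero h6
    have hg : dilationGain F = 0 := by
      unfold dilationGain
      rw [h12, mul_zero, div_zero]
    have hE := groundStateEnergy_lennardJones_le (enum_injective F)
    linarith
  · have h6pos : 0 < invPowSum 6 F := lt_of_le_of_ne (invPowSum_nonneg 6 F) (Ne.symm h6)
    have h12pos : 0 < invPowSum 12 F := by
      rcases (invPowSum_nonneg 12 F).lt_or_eq with h | h
      · exact h
      · -- `S₁₂ = 0` forces `S₆ = 0` (same argument with the roles of the exponents exchanged)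
        exfalso
        apply h6
        unfold invPowSum at h ⊢
        have hnn : ∀ y ∈ F, 0 ≤ ∑ w ∈ F, (dist y w)⁻¹ ^ 12 :=
          fun y _ => Finset.sum_nonneg fun w _ => pow_nonneg (inv_nonneg.2 dist_nonneg) _
        have h' := h.symm
        rw [Finset.sum_eq_zero_iff_of_nonneg hnn] at h'
        refine Finset.sum_eq_zero fun y hy => Finset.sum_eq_zero fun w hw => ?_
        have hy0 := h' y hy
        rw [Finset.sum_eq_zero_iff_of_nonneg (fun w _ => pow_nonneg (inv_nonneg.2 dist_nonneg) _)] at hy0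
        have h12' : (dist y w)⁻¹ ^ 12 = 0 := hy0 w hw
        have h0 : (dist y w)⁻¹ = 0 := pow_eq_zero_iff (by norm_num) |>.1 h12'
        rw [h0]
        norm_num
    -- the optimal dilation factor `λ⋆ = (S₁₂/S₆)^{1/6}`, so that `λ⋆⁻⁶ = m := S₆/S₁₂`
    set m : ℝ := invPowSum 6 F / invPowSum 12 F with hm
    have hmpos : 0 < m := div_pos h6pos h12pos
    set l : ℝ := (m⁻¹) ^ (1 / 6 : ℝ) with hl
    have hlpos : 0 < l := Real.rpow_pos_of_pos (inv_pos.2 hmpos) _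
    have hl6 : l ^ 6 = m⁻¹ := by
      rw [hl, ← Real.rpow_natCast, ← Real.rpow_mul (inv_pos.2 hmpos).le]
      norm_num
    have hli6 : l⁻¹ ^ 6 = m := by
      rw [inv_pow, hl6, inv_inv]
    have hli12 : l⁻¹ ^ 12 = m ^ 2 := by
      rw [show (12 : ℕ) = 6 * 2 by norm_num, pow_mul, hli6]
    -- its energy
    have hcomp := interactionEnergy_dilate F hlpos.le
    rw [hli6, hli12] at hcomp
    have hinj : Function.Injective (fun i => l • enum F i) := by
      intro i j hij
      have hij' : l • enum F i = l • enum F j := hij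
      exact enum_injective F (smul_right_injective _ hlpos.ne' hij')
    have hE := groundStateEnergy_lennardJones_le hinj
    -- algebra: `m² S₁₂/24 − m S₆/12 = U(F) − dilationGain F`
    have hval : m ^ 2 * invPowSum 12 F / 24 - m * invPowSum 6 F / 12 =
        invPowSum 12 F / 24 - invPowSum 6 F / 12 - dilationGain F := by
      unfold dilationGain
      rw [hm]
      field_simp
      ring
    rw [half_sum_sum_lennardJones]
    linarith [hval]

/-! ## §2  The dilation test and the cone of the split -/

/-- **The dilation test**: `DilationStrainedCubes κ Y → StrainedCubes κ Y`. [this file] -/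
theorem strainedCubes_of_dilationStrained {κ : ℝ} {Y : Set (EuclideanSpace ℝ (Fin 3))} (h : DilationStrainedCubes κ Y) :
    StrainedCubes κ Y := by
  intro ℓ₀
  obtain ⟨ℓ, hℓ, c, F, hF, hle⟩ := h ℓ₀
  refine ⟨ℓ, hℓ, c, F, hF, ?_⟩
  have hd := groundStateEnergy_add_dilationGain_le F
  linarith

/-- A texture that is not virial-balanced has strained cubes. [this file] -/
theorem strainedCubes_of_not_virialBalanced {Y : Set (EuclideanSpace ℝ (Fin 3))} (h : ¬ VirialBalanced Y) :
    ∃ κ : ℝ, 0 < κ ∧ StrainedCubes κ Y := by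
  unfold VirialBalanced at h
  push Not at h
  obtain ⟨κ, hκ, hd⟩ := h
  exact ⟨κ, hκ, strainedCubes_of_dilationStrained hd⟩

/-- The sparse branch from the local test and the residual (the dilation test discharged). [this file] -/
theorem sparseChargeRelax_of_tests {T₀ D : ℝ} (hL : LocalRelaxationTest T₀ D) (hE : ElasticLiouvilleLaw T₀ D) :
    SparseChargeRelax T₀ D :=
  sparseChargeRelax_of_tests' (fun _ _ h => strainedCubes_of_dilationStrained h) hL hE

/-- **RELAX from the split**: `ChargeDensityRelax → LocalRelaxationTest → ElasticLiouvilleLaw → EdgeRelaxationLaw`. [this file] -/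
theorem edgeRelaxationLaw_of_split {T₀ D : ℝ} (hA : ChargeDensityRelax T₀ D) (hL : LocalRelaxationTest T₀ D)
    (hE : ElasticLiouvilleLaw T₀ D) : EdgeRelaxationLaw T₀ D :=
  edgeRelaxationLaw_of_chargeSplit hA (sparseChargeRelax_of_tests hL hE)

/-- The cone to the crux: `GrossCleanBallsU T₀ 10 → ChargeDensityRelax T₀ 10 → LocalRelaxationTest T₀ 10 → ElasticLiouvilleLaw T₀ 10 →
CleanlessExcessT → CoherentResidual 10 → RobustDefectLimitWindows` (`0 < T₀`). [this file] -/
theorem rdef_of_grossU_split_coherent {T₀ : ℝ} (hT : 0 < T₀) (hG : GrossCleanBallsU T₀ 10) (hA : ChargeDensityRelax T₀ 10)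
    (hL : LocalRelaxationTest T₀ 10) (hE : ElasticLiouvilleLaw T₀ 10) (hCE : CleanlessExcessT) (hR : CoherentResidual 10) :
    RobustDefectLimitWindows :=
  rdef_of_grossU_edgeRelaxation_coherent hT hG (edgeRelaxationLaw_of_split hA hL hE) hCE hR

/-- The cone at the record numerals `T₀ = 1/250`. [this file] -/
theorem rdef_of_grossU_split_record (hG : GrossCleanBallsU (1 / 250) 10) (hA : ChargeDensityRelax (1 / 250) 10)
    (hL : LocalRelaxationTest (1 / 250) 10) (hE : ElasticLiouvilleLaw (1 / 250) 10) (hCE : CleanlessExcessT)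
    (hR : CoherentResidual 10) : RobustDefectLimitWindows :=
  rdef_of_grossU_split_coherent (T₀ := 1 / 250) (by norm_num) hG hA hL hE hCE hR

end Summit.AtomisticToContinuum.Crystallization.Theorems.OverbindingBudgetElasticSplitDilation
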